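import Summits.BirchSwinnertonDyer.Rank1Residual.AdditivePotMult.GreenbergVatsalTransferCountOdd
import Summits.BirchSwinnertonDyer.Rank1Residual.AdditivePotMult.PotMultRamifiedLineKummerEqAt
import Summits.BirchSwinnertonDyer.Rank1Residual.X2.NonPrimitiveSelmerGVEquality
import HarnessLib

/-!
# "`Sel^{Σ₀}_{E₁}(ℚ_∞)[p]` and `Sel^{Σ₀}_{E₂}(ℚ_∞)[p]` have the same order" (Greenberg–Vatsal p. 27) at
# EVERY ODD prime `p` on every congruent pair of the four additive potentially-ordinary loci — the
# NON-PRIMITIVE SELMER GROUPS THEMSELVES, via the R-D identification (team n1011 row T-RD) and the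
# transfer count of FILE 2 (cell `b2b-bsdres`, team n1011, seat p12 (gen 5); row T-E3g-GV29o FILE 3;
# ROUTE-2 II.15.4 ARM α, kernel half)

HONEST FRAMING (cell `b2b-bsdres`, run/shared/lean/b2b/bsd-rank1-residual/, verbatim in every
file): the goal of the cell is to DELETE the COMBINATION-SHAPED residual classes of the
Birch–Swinnerton-Dyer formula for ALL analytic-rank `≤ 1` elliptic curves over `ℚ` — "full BSD
formula for every rank `≤ 1` curve in class `C`" assembled STRICTLY from published theorems — so
that the rank-`≤ 1` remainder becomes exactly the CONSTRUCTION-SHAPED classes, which are TYPED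
(missing-input `Prop`s), NOT attempted. This is not "finishing BSD". Team n1011: research routes on
CONSTRUCTION-SHAPED classes; prove what is provable now; no claim beyond stated classes; census
output = EVIDENCE, never a Literature fact; RESIDUAL-MAP marks UNCHANGED; nothing is booked by this
file. THEOREMS ONLY: no definition, no named fact; p05's `GordGreenbergKummerIdentification`, p07's
`PotMultRamifiedLineKummerEqAt`, eisenstein-p2's `X2.NonPrimitiveSelmerGVEquality` /
`GreenbergVatsalUnramifiedAway` / `GreenbergVatsalSelmerLink` are consumed BY NAME and untouched.

## What and why

GV p. 26: "The nonprimitive Selmer groups `Sel^{Σ₀}_E(ℚ_∞)_p` and `S^{Σ₀}_A(ℚ_∞)` also coincide";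
p. 27: "`Sel^{Σ₀}_{E_i}(ℚ_∞)[p] = S^{Σ₀}_{A_i}(ℚ_∞)[p] ≅ S^{Σ₀}_{A_i[p]}(ℚ_∞)` … the order of this group is
independent of `i`". FILE 2 proved the second clause for the GREENBERG-condition groups
`S^{S₀}_{E_i[p^∞]}(ℚ_∞)` of ramified ordinary data. eisenstein-p2 proved the first clause at a GOOD
ordinary `p` (`X2.NonPrimitiveSelmerGVEquality`, modulo the printed local statement at `p`). On the
ADDITIVE rows the local statement at `p` is the R-D identification `RamifiedLineKummerEqAt W p`
(`L.greenbergKer = W.localKerOver` for every ramified ordinary line `L` and every cyclotomic `κ`),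
which team n1011's row T-RD made a THEOREM on all four loci: p05's
`ClassX4Gord/ClassX3Gord.ramifiedLineKummerEqAt` (mod the PUBLISHED Greenberg 1999 Prop. 2.4 record
`hGrK`, A239) and p07's `PotMult/ClassX4M/ClassX3M.ramifiedLineKummerEqAt` (mod A40/A41).

* §1 `nonPrimitiveSelmerInfty_eq_gvSelmerInfty_of_greenbergKer_eq` — `E/ℚ`, `p` odd, `κ` CYCLOTOMIC,
  ANY Greenberg data `L` above `p` with `(L v).greenbergKer = localKerOver` at `v ∋ p`, `Σ₀ ∌ p`
  containing the bad primes `≠ p`: `Sel^{Σ₀}_E(ℚ_∞)_p = S^{Σ₀}_{E[p^∞]}(ℚ_∞)` (eisenstein-p2's proof,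
  datum-generic: `⊆` by `localKerOver_le_unramKer` + the identity at `p`; `⊇` by GV p. 17
  `conjH1_mem_localKerOver_of_mem_gvSelmerInfty_of_isCyclotomic` + `∞` vacuous for odd `p`);
  `natCard_torsionBy_eq_natCard_inf_torsionBy` (pure algebra) and the count form.
* §2 `natCard_torsionBy_nonPrimitiveSelmerInfty_eq_of_forall_lines` — two curves: FILE 2's
  `ℚ`-assembly + §1 ⟹ `#Sel^{S₀}_{E₁}(ℚ_∞)_p[p] = #Sel^{S₀}_{E₂}(ℚ_∞)_p[p]`.
* §3 the four loci: `ClassX4Gord/ClassX3Gord.natCard_torsionBy_nonPrimitiveSelmerInfty_eq` (mod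
  `hGrK`), `ClassX4M/ClassX3M.…` (mod A40/A41), mixed `ClassX4M.…_of_classX4Gord`,
  `ClassX3M.…_of_classX3Gord` (mod both) — GV p. 27's sentence, verbatim object, every odd `p`.

NOT given here (the remaining content of cc-typer-2's composed record A240): the `Λ`-module
reading — the `μ = 0` transfer and `λ(X₁) + Σδ₁ = λ(X₂) + Σδ₂` need GV Cor. (2.3)/Prop. (2.4) and
Prop. (2.5)/Remark (2.7) (`#Sel^{Σ₀}[p] = p^{λ}`), `Λ`-module theory the tree lacks (typer lane).
Nothing booked; X3♯/X4♯ stay as labelled.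

References: [GreenbergVatsal2000] §2 pp. 17, 19, 26–27 (held text `paper:arxiv-math_9906215`);
[GreenbergLNM1716] §2 pp. 69–75, Prop. 2.4; [SilvermanATAEC1994] V.5.3/5.4; ROUTE-2 II.15.3–15.4.
-/

set_option autoImplicit false

noncomputable section

open scoped Classical NumberField AddSubgroup

open NumberField IsDedekindDomain Field WeierstrassCurve
  Literature.NumberTheory.GaloisRepresentations Literature.NumberTheory.EllipticCurves
  Literature.NumberTheory.EllipticCurves.GreenbergSelmer
  Literature.NumberTheory.EllipticCurves.GreenbergVatsal2000
  Literature.NumberTheory.EllipticCurves.EmertonPollackWeston2006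
  Literature.NumberTheory.EllipticCurves.Rank1Residual
  Literature.NumberTheory.EllipticCurves.Greenberg1999
  Summit.BirchSwinnertonDyer.Rank1Residual.X2.TorsionComparison
  Summit.BirchSwinnertonDyer.Rank1Residual.X2.GreenbergVatsalTorsion
  Summit.BirchSwinnertonDyer.Rank1Residual.X2.GreenbergVatsalSelmerEquality
  Summit.BirchSwinnertonDyer.Rank1Residual.X2.GreenbergVatsalSelmerLink
  Summit.BirchSwinnertonDyer.Rank1Residual.X2.GreenbergVatsalUnramifiedAway

/-! ## §1. `Sel^{Σ₀}_E(ℚ_∞)_p = S^{Σ₀}_{E[p^∞]}(ℚ_∞)` for any datum with the R-D identity at `p` -/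

namespace Summit.BirchSwinnertonDyer.Rank1Residual.Additive

open Summit.BirchSwinnertonDyer.Rank1Residual.X1.CongruenceTransfer (TorsionIso)

section Link

variable (W : WeierstrassCurve ℚ) [W.IsElliptic] (p : ℕ) [hp : Fact p.Prime]
  (κ : ZpExtension ℚ p) (S₀ : Set (HeightOneSpectrum (𝓞 ℚ)))

/-- **`Sel^{Σ₀}_E(ℚ_∞)_p = S^{Σ₀}_{E[p^∞]}(ℚ_∞)` for ANY Greenberg data with the R-D identity at `p`.**
`E/ℚ` globally minimal, `p` odd, `κ` cyclotomic, `L` Greenberg data above `p` with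
`(L v).greenbergKer (ker κ) = localKerOver` at the place `v ∋ p` (for a ramified ordinary line: team
n1011's `RamifiedLineKummerEqAt W p`), `Σ₀ ∌ p`, `E` good outside `Σ₀ ∪ {p}`. Then GV's printed
non-primitive Selmer group (Kummer conditions at every place of `ℚ_∞` not above `Σ₀`) IS
`S^{Σ₀}_{E[p^∞]}(ℚ_∞)` (unramified at good `v ∉ Σ₀ ∪ {p}`, Greenberg's condition at `p`).
eisenstein-p2's `nonPrimitiveSelmerInfty_eq_gvSelmerInfty_of_le`, datum-generic.
[cite: GreenbergVatsal2000, §2 pp. 17, 26] [cite: GreenbergLNM1716, §2 pp. 69–75] -/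
theorem nonPrimitiveSelmerInfty_eq_gvSelmerInfty_of_greenbergKer_eq (hp2 : p ≠ 2)
    (hκ : κ.IsCyclotomic) (L : Data ℚ (W.geomPrimaryTorsion p) p)
    (hRD : ∀ (v : HeightOneSpectrum (𝓞 ℚ)) (hv : ((p : ℕ) : 𝓞 ℚ) ∈ v.asIdeal),
      (L v hv).greenbergKer κ.kerSubgroup = W.localKerOver p κ.kerSubgroup (v.adicCompletion ℚ))
    (hS₀ : ∀ v ∈ S₀, ((p : ℕ) : 𝓞 ℚ) ∉ v.asIdeal)
    (hS : ∀ v : HeightOneSpectrum (𝓞 ℚ), v ∉ S₀ → ((p : ℕ) : 𝓞 ℚ) ∉ v.asIdeal →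
      W.HasGoodReductionAt v) :
    nonPrimitiveSelmerInfty W κ S₀ = gvSelmerInfty κ (W.geomPrimaryTorsion p) L S₀ := by
  apply le_antisymm
  · intro c hc
    have hc' : c ∈ nonPrimitiveSelmerGroupOver W p κ.kerSubgroup S₀ := hc
    rw [mem_nonPrimitiveSelmerGroupOver_iff] at hc'
    change c ∈ gvSelmer κ.kerSubgroup (W.geomPrimaryTorsion p) p L S₀
    rw [mem_gvSelmer_iff]
    refine ⟨fun v hv hpv σ ↦ localKerOver_le_unramKer W p κ.kerSubgroup (hS v hv hpv) hpv
      (hc'.1 v hv σ), fun v hv σ ↦ ?_⟩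
    rw [hRD v hv]
    exact hc'.1 v (fun hvS ↦ hS₀ v hvS hv) σ
  · intro c hgv
    change c ∈ nonPrimitiveSelmerGroupOver W p κ.kerSubgroup S₀
    rw [mem_nonPrimitiveSelmerGroupOver_iff]
    refine ⟨fun v hvS σ ↦ ?_, fun w σ ↦ ?_⟩
    · by_cases hpv : ((p : ℕ) : 𝓞 ℚ) ∈ v.asIdeal
      · rw [← hRD v hpv]
        exact ((mem_gvSelmer_iff c).1 hgv).2 v hpv σ
      · exact conjH1_mem_localKerOver_of_mem_gvSelmerInfty_of_isCyclotomic (κ := κ) (v := v)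
          (W := W) (p := p) hκ L S₀ hgv hvS (hS v hvS hpv) hpv σ
    · rw [localKerOver_completion_eq_top_of_odd W p hp2]
      exact AddSubgroup.mem_top _

omit hp in
/-- Pure algebra: for subgroups `A = B` of an additive group `G`, `#A[n] = #(B ⊓ G[n])`. [folklore] -/
theorem natCard_torsionBy_eq_natCard_inf_torsionBy {G : Type*} [AddCommGroup G] {A B : AddSubgroup G}
    (heq : A = B) (n : ℕ) :
    Nat.card (A[(n : ℤ)]) = Nat.card (B ⊓ G[(n : ℤ)] : AddSubgroup G) := by
  subst heq
  refine Nat.card_congr (Equiv.ofBijective (fun x ↦ ⟨((x : A) : G), ?_⟩) ⟨?_, ?_⟩)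
  · refine AddSubgroup.mem_inf.2 ⟨(x : A).2, AddSubgroup.torsionBy.nsmul_iff.mpr ?_⟩
    have hx : n • ((x : A[(n : ℤ)]) : A) = 0 := by exact_mod_cast AddSubgroup.torsionBy.nsmul x
    exact_mod_cast congrArg (fun t : A ↦ (t : G)) hx
  · intro x y hxy
    exact Subtype.ext (Subtype.ext (by simpa using congrArg Subtype.val hxy))
  · intro y
    obtain ⟨hy1, hy2⟩ := AddSubgroup.mem_inf.1 y.2
    have hy2' : n • (y : G) = 0 := AddSubgroup.torsionBy.nsmul_iff.mp hy2
    refine ⟨⟨⟨y, hy1⟩, AddSubgroup.torsionBy.nsmul_iff.mpr (Subtype.ext ?_)⟩, rfl⟩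
    rw [AddSubgroupClass.coe_nsmul]
    exact hy2'

/-- **`#Sel^{Σ₀}_E(ℚ_∞)_p[p] = #(S^{Σ₀}_{E[p^∞]}(ℚ_∞) ⊓ H¹[p])`** under §1's hypotheses — the
`p`-torsion of GV's non-primitive Selmer group IS the object counted by the kernel transfer.
[cite: GreenbergVatsal2000, §2 pp. 26–27] -/
theorem natCard_torsionBy_nonPrimitiveSelmerInfty_eq_of_greenbergKer_eq (hp2 : p ≠ 2)
    (hκ : κ.IsCyclotomic) (L : Data ℚ (W.geomPrimaryTorsion p) p)
    (hRD : ∀ (v : HeightOneSpectrum (𝓞 ℚ)) (hv : ((p : ℕ) : 𝓞 ℚ) ∈ v.asIdeal),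
      (L v hv).greenbergKer κ.kerSubgroup = W.localKerOver p κ.kerSubgroup (v.adicCompletion ℚ))
    (hS₀ : ∀ v ∈ S₀, ((p : ℕ) : 𝓞 ℚ) ∉ v.asIdeal)
    (hS : ∀ v : HeightOneSpectrum (𝓞 ℚ), v ∉ S₀ → ((p : ℕ) : 𝓞 ℚ) ∉ v.asIdeal →
      W.HasGoodReductionAt v) :
    Nat.card ((nonPrimitiveSelmerInfty W κ S₀)[(p : ℤ)]) =
      Nat.card (gvSelmerInfty κ (W.geomPrimaryTorsion p) L S₀ ⊓
        (subgroupH1 κ.kerSubgroup (W.geomPrimaryTorsion p))[(p : ℤ)] :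
        AddSubgroup (subgroupH1 κ.kerSubgroup (W.geomPrimaryTorsion p))) :=
  natCard_torsionBy_eq_natCard_inf_torsionBy
    (nonPrimitiveSelmerInfty_eq_gvSelmerInfty_of_greenbergKer_eq W p κ S₀ hp2 hκ L hRD hS₀ hS) p

end Link

/-! ## §2. Two curves: `#Sel^{Σ₀}_{E₁}(ℚ_∞)_p[p] = #Sel^{Σ₀}_{E₂}(ℚ_∞)_p[p]` -/

section Pair

variable {p : ℕ} [hp : Fact p.Prime] {W₁ W₂ : WeierstrassCurve ℚ} [W₁.IsElliptic]
  [W₁.IsGloballyMinimal] [W₂.IsElliptic] [W₂.IsGloballyMinimal] (κ : ZpExtension ℚ p)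
  (S₀ : Set (HeightOneSpectrum (𝓞 ℚ)))

omit [W₁.IsGloballyMinimal] [W₂.IsGloballyMinimal] in
/-- **GV p. 27, the sentence itself: `#Sel^{Σ₀}_{E₁}(ℚ_∞)_p[p] = #Sel^{Σ₀}_{E₂}(ℚ_∞)_p[p]`.**
`E₁, E₂/ℚ` globally minimal, `p` odd, `κ` cyclotomic; at the place `v ∋ p` ramified ordinary lines
with the Remark-(2.9) clause that MATCH under every congruence (FILE 1 — all four loci); the R-D
identification `RamifiedLineKummerEqAt W_i p` for both curves (team n1011 row T-RD: a THEOREM on the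
four loci mod `hGrK` / A40–A41); `p ∤ #E₁(ℚ)_tors`; `Σ₀ ∌ p` containing the bad primes `≠ p` of
both; `E₁[p] ≅ E₂[p]` (`TorsionIso`). FILE 2's assembly + §1 on both sides.
[cite: GreenbergVatsal2000, §2 Prop. (2.8), Remark (2.9) and pp. 26–27] -/
theorem natCard_torsionBy_nonPrimitiveSelmerInfty_eq_of_forall_lines (hp2 : p ≠ 2)
    (hκ : κ.IsCyclotomic)
    (hlines : ∀ (v : HeightOneSpectrum (𝓞 ℚ)) (hv : ((p : ℕ) : 𝓞 ℚ) ∈ v.asIdeal),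
      ∃ (L₁ : LocalDatum ℚ (W₁.geomPrimaryTorsion p) v) (L₂ : LocalDatum ℚ (W₂.geomPrimaryTorsion p) v),
        IsRamifiedOrdinaryLine W₁ p L₁ ∧ IsRamifiedOrdinaryLine W₂ p L₂ ∧
        (∀ a ∈ invariants (inertiaIn κ.kerSubgroup v) L₁.Gr, a = 0) ∧
        (∀ a ∈ invariants (inertiaIn κ.kerSubgroup v) L₂.Gr, a = 0) ∧
        ∀ e : geomTorsion W₁ (p : ℤ) ≃+ geomTorsion W₂ (p : ℤ),
          (∀ (σ : absoluteGaloisGroup ℚ) (P : geomTorsion W₁ (p : ℤ)), e (σ • P) = σ • e P) →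
          ∀ P : geomTorsion W₁ (p : ℤ),
            AddSubgroup.inclusion (geomTorsion_le_geomPrimaryTorsion W₁ p) P ∈ L₁.plus ↔
              AddSubgroup.inclusion (geomTorsion_le_geomPrimaryTorsion W₂ p) (e P) ∈ L₂.plus)
    (hRD₁ : RamifiedLineKummerEqAt W₁ p) (hRD₂ : RamifiedLineKummerEqAt W₂ p)
    (htors₁ : ¬ p ∣ W₁.torsionOrder)
    (hS₀ : ∀ v ∈ S₀, ((p : ℕ) : 𝓞 ℚ) ∉ v.asIdeal)
    (hS₁ : ∀ v : HeightOneSpectrum (𝓞 ℚ), v ∉ S₀ → ((p : ℕ) : 𝓞 ℚ) ∉ v.asIdeal →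
      W₁.HasGoodReductionAt v)
    (hS₂ : ∀ v : HeightOneSpectrum (𝓞 ℚ), v ∉ S₀ → ((p : ℕ) : 𝓞 ℚ) ∉ v.asIdeal →
      W₂.HasGoodReductionAt v)
    (hT : TorsionIso W₁ W₂ p) :
    Nat.card ((nonPrimitiveSelmerInfty W₁ κ S₀)[(p : ℤ)]) =
      Nat.card ((nonPrimitiveSelmerInfty W₂ κ S₀)[(p : ℤ)]) := by
  obtain ⟨L₁, L₂, hL₁, hL₂, hcount⟩ :=
    exists_data_natCard_gvSelmerInfty_inf_torsion_eq_of_forall_lines κ S₀ hlines htors₁ hS₁ hS₂ hT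
  rw [natCard_torsionBy_nonPrimitiveSelmerInfty_eq_of_greenbergKer_eq W₁ p κ S₀ hp2 hκ L₁
      (fun v hv ↦ hRD₁ κ hκ v hv (L₁ v hv) (hL₁ v hv)) hS₀ hS₁,
    natCard_torsionBy_nonPrimitiveSelmerInfty_eq_of_greenbergKer_eq W₂ p κ S₀ hp2 hκ L₂
      (fun v hv ↦ hRD₂ κ hκ v hv (L₂ v hv) (hL₂ v hv)) hS₀ hS₂]
  exact hcount

/-! ## §3. The four loci -/

/-- **X4♯(G-ord, `e = 2`) × X4♯(G-ord, `e = 2`), every odd `p`: `#Sel^{Σ₀}_{E₁}(ℚ_∞)_p[p] =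
#Sel^{Σ₀}_{E₂}(ℚ_∞)_p[p]`**, modulo the PUBLISHED Greenberg 1999 Prop. 2.4 record `hGrK` (A239, the
R-D input of p05's `ClassX4Gord.ramifiedLineKummerEqAt`); everything else in the kernel. X4♯ stays
CONSTRUCTION-SHAPED; nothing booked. [cite: GreenbergVatsal2000, §2 pp. 26–27]
[cite: GreenbergLNM1716, §2 Prop. 2.4 (p. 80)] -/
theorem ClassX4Gord.natCard_torsionBy_nonPrimitiveSelmerInfty_eq
    (hGrK : imKummer_ge_strictCondition_goodOrdinary) (hκ : κ.IsCyclotomic)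
    (hX₁ : ClassX4Gord W₁ p) (he₁ : semistabilityIndex W₁ p = 2)
    (hX₂ : ClassX4Gord W₂ p) (he₂ : semistabilityIndex W₂ p = 2)
    (hS₀ : ∀ v ∈ S₀, ((p : ℕ) : 𝓞 ℚ) ∉ v.asIdeal)
    (hS₁ : ∀ v : HeightOneSpectrum (𝓞 ℚ), v ∉ S₀ → ((p : ℕ) : 𝓞 ℚ) ∉ v.asIdeal →
      W₁.HasGoodReductionAt v)
    (hS₂ : ∀ v : HeightOneSpectrum (𝓞 ℚ), v ∉ S₀ → ((p : ℕ) : 𝓞 ℚ) ∉ v.asIdeal →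
      W₂.HasGoodReductionAt v)
    (hT : TorsionIso W₁ W₂ p) :
    Nat.card ((nonPrimitiveSelmerInfty W₁ κ S₀)[(p : ℤ)]) =
      Nat.card ((nonPrimitiveSelmerInfty W₂ κ S₀)[(p : ℤ)]) :=
  natCard_torsionBy_nonPrimitiveSelmerInfty_eq_of_forall_lines κ S₀ hX₁.addv.1 hκ
    (fun v hv ↦ by
      obtain ⟨L₁, L₂, hL₁, hL₂, hm⟩ :=
        AdditivePotMult.GreenbergVatsalTransferCountOdd.exists_lines_matching_of_typeGOrd_typeGOrd
          hX₁.addv.1 hX₁.typeGOrd hX₁.addv.2 he₁ hX₂.typeGOrd hX₂.addv.2 he₂ hv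
      exact ⟨L₁, L₂, hL₁, hL₂, hX₁.gr_invariants_eq_zero_of_isRamifiedOrdinaryLine κ he₁ hv hL₁,
        hX₂.gr_invariants_eq_zero_of_isRamifiedOrdinaryLine κ he₂ hv hL₂, hm⟩)
    (ClassX4Gord.ramifiedLineKummerEqAt hGrK hX₁ he₁) (ClassX4Gord.ramifiedLineKummerEqAt hGrK hX₂ he₂)
    (not_dvd_torsionOrder_of_irr' p W₁ hX₁.1.2.2) hS₀ hS₁ hS₂ hT

/-- **X3♯(G-ord, `e = 2`) × X3♯(G-ord, `e = 2`), odd `p` (REDUCIBLE `E_i[p]`):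
`#Sel^{Σ₀}_{E₁}(ℚ_∞)_p[p] = #Sel^{Σ₀}_{E₂}(ℚ_∞)_p[p]`**, mod `hGrK`, with the census bit `p ∤ #E₁(ℚ)_tors`.
X3♯ stays as labelled; nothing booked. [cite: GreenbergVatsal2000, §2 pp. 26–27]
[cite: GreenbergLNM1716, §2 Prop. 2.4 (p. 80)] -/
theorem ClassX3Gord.natCard_torsionBy_nonPrimitiveSelmerInfty_eq
    (hGrK : imKummer_ge_strictCondition_goodOrdinary) (hp2 : p ≠ 2) (hκ : κ.IsCyclotomic)
    (hX₁ : ClassX3Gord W₁ p) (he₁ : semistabilityIndex W₁ p = 2)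
    (hX₂ : ClassX3Gord W₂ p) (he₂ : semistabilityIndex W₂ p = 2)
    (htors₁ : ¬ p ∣ W₁.torsionOrder)
    (hS₀ : ∀ v ∈ S₀, ((p : ℕ) : 𝓞 ℚ) ∉ v.asIdeal)
    (hS₁ : ∀ v : HeightOneSpectrum (𝓞 ℚ), v ∉ S₀ → ((p : ℕ) : 𝓞 ℚ) ∉ v.asIdeal →
      W₁.HasGoodReductionAt v)
    (hS₂ : ∀ v : HeightOneSpectrum (𝓞 ℚ), v ∉ S₀ → ((p : ℕ) : 𝓞 ℚ) ∉ v.asIdeal →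
      W₂.HasGoodReductionAt v)
    (hT : TorsionIso W₁ W₂ p) :
    Nat.card ((nonPrimitiveSelmerInfty W₁ κ S₀)[(p : ℤ)]) =
      Nat.card ((nonPrimitiveSelmerInfty W₂ κ S₀)[(p : ℤ)]) :=
  natCard_torsionBy_nonPrimitiveSelmerInfty_eq_of_forall_lines κ S₀ hp2 hκ
    (fun v hv ↦ by
      obtain ⟨L₁, L₂, hL₁, hL₂, hm⟩ :=
        AdditivePotMult.GreenbergVatsalTransferCountOdd.exists_lines_matching_of_typeGOrd_typeGOrd
          hp2 hX₁.typeGOrd hX₁.addv he₁ hX₂.typeGOrd hX₂.addv he₂ hv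
      exact ⟨L₁, L₂, hL₁, hL₂,
        ClassX3Gord.gr_invariants_eq_zero_of_isRamifiedOrdinaryLine κ hp2 hX₁ he₁ hv hL₁,
        ClassX3Gord.gr_invariants_eq_zero_of_isRamifiedOrdinaryLine κ hp2 hX₂ he₂ hv hL₂, hm⟩)
    (ClassX3Gord.ramifiedLineKummerEqAt hGrK hp2 hX₁ he₁)
    (ClassX3Gord.ramifiedLineKummerEqAt hGrK hp2 hX₂ he₂) htors₁ hS₀ hS₁ hS₂ hT

end Pair
end Summit.BirchSwinnertonDyer.Rank1Residual.Additive

namespace Summit.BirchSwinnertonDyer.Rank1Residual.AdditivePotMult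

open Summit.BirchSwinnertonDyer.Rank1Residual.Additive
open Summit.BirchSwinnertonDyer.Rank1Residual.X1.CongruenceTransfer (TorsionIso)

section PotMultPairs

variable {p : ℕ} [hp : Fact p.Prime] {W₁ W₂ : WeierstrassCurve ℚ} [W₁.IsElliptic] [W₂.IsElliptic]
  (κ : ZpExtension ℚ p) (S₀ : Set (HeightOneSpectrum (𝓞 ℚ)))

/-- **X4(M) × X4(M), every odd `p` (`p = 3` included): `#Sel^{Σ₀}_{E₁}(ℚ_∞)_p[p] = #Sel^{Σ₀}_{E₂}(ℚ_∞)_p[p]`**,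
modulo the PUBLISHED Tate uniformisation A40/A41 only (lines, their matching, the Remark-(2.9) clause
and the R-D identification `ClassX4M.ramifiedLineKummerEqAt` all mod A40/A41). X4(M) stays
CONSTRUCTION-SHAPED; nothing booked. [cite: GreenbergVatsal2000, §2 pp. 26–27]
[cite: SilvermanATAEC1994, Ch. V Thm. 5.3, Cor. 5.4] -/
theorem ClassX4M.natCard_torsionBy_nonPrimitiveSelmerInfty_eq
    (hT40 : Silverman1994_thmV53_tateUniformisation.{0})
    (hT41 : Silverman1994_thmV53_corV54_tateUniformisation.{0}) (hκ : κ.IsCyclotomic)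
    (hX₁ : ClassX4M W₁ p) (hX₂ : ClassX4M W₂ p)
    (hS₀ : ∀ v ∈ S₀, ((p : ℕ) : 𝓞 ℚ) ∉ v.asIdeal)
    (hS₁ : ∀ v : HeightOneSpectrum (𝓞 ℚ), v ∉ S₀ → ((p : ℕ) : 𝓞 ℚ) ∉ v.asIdeal →
      W₁.HasGoodReductionAt v)
    (hS₂ : ∀ v : HeightOneSpectrum (𝓞 ℚ), v ∉ S₀ → ((p : ℕ) : 𝓞 ℚ) ∉ v.asIdeal →
      W₂.HasGoodReductionAt v)
    (hT : TorsionIso W₁ W₂ p) :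
    Nat.card ((nonPrimitiveSelmerInfty W₁ κ S₀)[(p : ℤ)]) =
      Nat.card ((nonPrimitiveSelmerInfty W₂ κ S₀)[(p : ℤ)]) :=
  natCard_torsionBy_nonPrimitiveSelmerInfty_eq_of_forall_lines κ S₀ hX₁.p_ne_two hκ
    (fun v hv ↦ by
      obtain ⟨L₁, L₂, hL₁, hL₂, hm⟩ := PotMult.exists_lines_matching hT40 hT41
        (ClassX4M.potMult W₁ p hX₁) (ClassX4M.potMult W₂ p hX₂) hX₁.p_ne_two hv
      exact ⟨L₁, L₂, hL₁, hL₂,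
        ClassX4M.gr_invariants_eq_zero_of_isRamifiedOrdinaryLine κ hT40 hT41 hX₁ hv hL₁,
        ClassX4M.gr_invariants_eq_zero_of_isRamifiedOrdinaryLine κ hT40 hT41 hX₂ hv hL₂, hm⟩)
    (ClassX4M.ramifiedLineKummerEqAt hT40 hT41 hX₁) (ClassX4M.ramifiedLineKummerEqAt hT40 hT41 hX₂)
    (not_dvd_torsionOrder_of_irr' p W₁ hX₁.1.2.2) hS₀ hS₁ hS₂ hT

/-- **X3♯(M) × X3♯(M), odd `p` (REDUCIBLE `E_i[p]`): `#Sel^{Σ₀}_{E₁}(ℚ_∞)_p[p] = #Sel^{Σ₀}_{E₂}(ℚ_∞)_p[p]`**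
(mod A40/A41; census bit `p ∤ #E₁(ℚ)_tors`). X3♯(M) stays as labelled; nothing booked.
[cite: GreenbergVatsal2000, §2 pp. 26–27] [cite: SilvermanATAEC1994, Ch. V Thm. 5.3, Cor. 5.4] -/
theorem ClassX3M.natCard_torsionBy_nonPrimitiveSelmerInfty_eq [W₁.IsGloballyMinimal]
    [W₂.IsGloballyMinimal] (hT40 : Silverman1994_thmV53_tateUniformisation.{0})
    (hT41 : Silverman1994_thmV53_corV54_tateUniformisation.{0}) (hκ : κ.IsCyclotomic)
    (hX₁ : ClassX3M W₁ p) (hX₂ : ClassX3M W₂ p) (htors₁ : ¬ p ∣ W₁.torsionOrder)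
    (hS₀ : ∀ v ∈ S₀, ((p : ℕ) : 𝓞 ℚ) ∉ v.asIdeal)
    (hS₁ : ∀ v : HeightOneSpectrum (𝓞 ℚ), v ∉ S₀ → ((p : ℕ) : 𝓞 ℚ) ∉ v.asIdeal →
      W₁.HasGoodReductionAt v)
    (hS₂ : ∀ v : HeightOneSpectrum (𝓞 ℚ), v ∉ S₀ → ((p : ℕ) : 𝓞 ℚ) ∉ v.asIdeal →
      W₂.HasGoodReductionAt v)
    (hT : TorsionIso W₁ W₂ p) :
    Nat.card ((nonPrimitiveSelmerInfty W₁ κ S₀)[(p : ℤ)]) =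
      Nat.card ((nonPrimitiveSelmerInfty W₂ κ S₀)[(p : ℤ)]) :=
  natCard_torsionBy_nonPrimitiveSelmerInfty_eq_of_forall_lines κ S₀ (ClassX3M.p_ne_two W₁ p hX₁) hκ
    (fun v hv ↦ by
      obtain ⟨L₁, L₂, hL₁, hL₂, hm⟩ := PotMult.exists_lines_matching hT40 hT41
        (ClassX3M.potMult W₁ p hX₁) (ClassX3M.potMult W₂ p hX₂) (ClassX3M.p_ne_two W₁ p hX₁) hv
      exact ⟨L₁, L₂, hL₁, hL₂,
        ClassX3M.gr_invariants_eq_zero_of_isRamifiedOrdinaryLine κ hT40 hT41 hX₁ hv hL₁,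
        ClassX3M.gr_invariants_eq_zero_of_isRamifiedOrdinaryLine κ hT40 hT41 hX₂ hv hL₂, hm⟩)
    (ClassX3M.ramifiedLineKummerEqAt hT40 hT41 hX₁) (ClassX3M.ramifiedLineKummerEqAt hT40 hT41 hX₂)
    htors₁ hS₀ hS₁ hS₂ hT

end PotMultPairs

section Mixed

variable {p : ℕ} [hp : Fact p.Prime] {W₁ W₂ : WeierstrassCurve ℚ} [W₁.IsElliptic]
  [W₁.IsGloballyMinimal] [W₂.IsElliptic] (κ : ZpExtension ℚ p) (S₀ : Set (HeightOneSpectrum (𝓞 ℚ)))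

/-- **X4♯(G-ord, `e = 2`) × X4(M), every odd `p`: `#Sel^{Σ₀}_{E₁}(ℚ_∞)_p[p] = #Sel^{Σ₀}_{E₂}(ℚ_∞)_p[p]`**
(mod `hGrK` on the (G-ord) side and A40/A41 on the (M) side). Nothing booked.
[cite: GreenbergVatsal2000, §2 pp. 26–27] [cite: SilvermanATAEC1994, Ch. V Thm. 5.3, Cor. 5.4] -/
theorem ClassX4M.natCard_torsionBy_nonPrimitiveSelmerInfty_eq_of_classX4Gord
    (hGrK : imKummer_ge_strictCondition_goodOrdinary)
    (hT40 : Silverman1994_thmV53_tateUniformisation.{0})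
    (hT41 : Silverman1994_thmV53_corV54_tateUniformisation.{0}) (hκ : κ.IsCyclotomic)
    (hX₁ : ClassX4Gord W₁ p) (he₁ : semistabilityIndex W₁ p = 2) (hX₂ : ClassX4M W₂ p)
    (hS₀ : ∀ v ∈ S₀, ((p : ℕ) : 𝓞 ℚ) ∉ v.asIdeal)
    (hS₁ : ∀ v : HeightOneSpectrum (𝓞 ℚ), v ∉ S₀ → ((p : ℕ) : 𝓞 ℚ) ∉ v.asIdeal →
      W₁.HasGoodReductionAt v)
    (hS₂ : ∀ v : HeightOneSpectrum (𝓞 ℚ), v ∉ S₀ → ((p : ℕ) : 𝓞 ℚ) ∉ v.asIdeal →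
      W₂.HasGoodReductionAt v)
    (hT : TorsionIso W₁ W₂ p) :
    Nat.card ((nonPrimitiveSelmerInfty W₁ κ S₀)[(p : ℤ)]) =
      Nat.card ((nonPrimitiveSelmerInfty W₂ κ S₀)[(p : ℤ)]) :=
  natCard_torsionBy_nonPrimitiveSelmerInfty_eq_of_forall_lines κ S₀ hX₁.addv.1 hκ
    (fun v hv ↦ by
      obtain ⟨L₁, L₂, hL₁, hL₂, hm⟩ :=
        RamifiedOrdinaryLineMatchingMixed.exists_lines_matching_of_typeGOrd_potMult hT40 hT41
          hX₁.addv.1 hX₁.typeGOrd hX₁.addv.2 he₁ (ClassX4M.potMult W₂ p hX₂) hv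
      exact ⟨L₁, L₂, hL₁, hL₂, hX₁.gr_invariants_eq_zero_of_isRamifiedOrdinaryLine κ he₁ hv hL₁,
        ClassX4M.gr_invariants_eq_zero_of_isRamifiedOrdinaryLine κ hT40 hT41 hX₂ hv hL₂, hm⟩)
    (ClassX4Gord.ramifiedLineKummerEqAt hGrK hX₁ he₁) (ClassX4M.ramifiedLineKummerEqAt hT40 hT41 hX₂)
    (not_dvd_torsionOrder_of_irr' p W₁ hX₁.1.2.2) hS₀ hS₁ hS₂ hT

/-- **X3♯(G-ord, `e = 2`) × X3♯(M), odd `p`: `#Sel^{Σ₀}_{E₁}(ℚ_∞)_p[p] = #Sel^{Σ₀}_{E₂}(ℚ_∞)_p[p]`**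
(mod `hGrK` / A40–A41; census bit `p ∤ #E₁(ℚ)_tors`). Nothing booked.
[cite: GreenbergVatsal2000, §2 pp. 26–27] [cite: SilvermanATAEC1994, Ch. V Thm. 5.3, Cor. 5.4] -/
theorem ClassX3M.natCard_torsionBy_nonPrimitiveSelmerInfty_eq_of_classX3Gord [W₂.IsGloballyMinimal]
    (hGrK : imKummer_ge_strictCondition_goodOrdinary)
    (hT40 : Silverman1994_thmV53_tateUniformisation.{0})
    (hT41 : Silverman1994_thmV53_corV54_tateUniformisation.{0}) (hp2 : p ≠ 2) (hκ : κ.IsCyclotomic)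
    (hX₁ : ClassX3Gord W₁ p) (he₁ : semistabilityIndex W₁ p = 2) (hX₂ : ClassX3M W₂ p)
    (htors₁ : ¬ p ∣ W₁.torsionOrder)
    (hS₀ : ∀ v ∈ S₀, ((p : ℕ) : 𝓞 ℚ) ∉ v.asIdeal)
    (hS₁ : ∀ v : HeightOneSpectrum (𝓞 ℚ), v ∉ S₀ → ((p : ℕ) : 𝓞 ℚ) ∉ v.asIdeal →
      W₁.HasGoodReductionAt v)
    (hS₂ : ∀ v : HeightOneSpectrum (𝓞 ℚ), v ∉ S₀ → ((p : ℕ) : 𝓞 ℚ) ∉ v.asIdeal →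
      W₂.HasGoodReductionAt v)
    (hT : TorsionIso W₁ W₂ p) :
    Nat.card ((nonPrimitiveSelmerInfty W₁ κ S₀)[(p : ℤ)]) =
      Nat.card ((nonPrimitiveSelmerInfty W₂ κ S₀)[(p : ℤ)]) :=
  natCard_torsionBy_nonPrimitiveSelmerInfty_eq_of_forall_lines κ S₀ hp2 hκ
    (fun v hv ↦ by
      obtain ⟨L₁, L₂, hL₁, hL₂, hm⟩ :=
        RamifiedOrdinaryLineMatchingMixed.exists_lines_matching_of_typeGOrd_potMult hT40 hT41 hp2
          hX₁.typeGOrd hX₁.addv he₁ (ClassX3M.potMult W₂ p hX₂) hv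
      exact ⟨L₁, L₂, hL₁, hL₂,
        ClassX3Gord.gr_invariants_eq_zero_of_isRamifiedOrdinaryLine κ hp2 hX₁ he₁ hv hL₁,
        ClassX3M.gr_invariants_eq_zero_of_isRamifiedOrdinaryLine κ hT40 hT41 hX₂ hv hL₂, hm⟩)
    (ClassX3Gord.ramifiedLineKummerEqAt hGrK hp2 hX₁ he₁) (ClassX3M.ramifiedLineKummerEqAt hT40 hT41 hX₂)
    htors₁ hS₀ hS₁ hS₂ hT

end Mixed
end Summit.BirchSwinnertonDyer.Rank1Residual.AdditivePotMult
end
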